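import Mathlib
import Literature.AlgebraicGeometry.Resolution.NonRationalRealization
import Literature.AlgebraicGeometry.Resolution.PointStepPrepared
import HarnessLib

/-!
# One point blowing up at a NON-RATIONAL very near point: the prepared `β`-drop, case of a
# `𝐯`-prepared transported system

Topic: `Literature/AlgebraicGeometry/Resolution`. The non-rational point step of Cossart–Piltant 2008,
proof of Lemma 4.5 (2), pp. 12–13 («The hard part is now to control `i(x′)` at points in the first
chart distinct from `x′₀` … `β(E′; u′₁, v′; z′) ≤ ord_{v′}(G_i(1,u′₂))/i ≤ deg G_i/(i·[k(x′):k(x)])`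
(22). In particular, lemma 4.5 holds if `Δ(E′; u′₁, v′; z′)` is prepared: the middle inequality in
(22) is strict since `deg G_i/i = β(x) > 0` by (17) and `[k(x′):k(x)] > 1`») and of
Cossart–Jannsen–Saito, LNM 2270, Ch. 14 (arXiv 0905.2191 §13): Lemma 14.5 (`β ≥ γ⁺ ≥ d · β′`) and
Corollary 14.6 («If `(f′, y′, (u₁, φ′))` is not solvable at `v′`, Proposition 14.3 holds … it
suffices to take `z′ = y′`»), in the abstract non-rational chart of `NonRationalChart` /
`NonRationalRealization` (`c′ = (y′, φ u₁, P(t))`, `u₂ = u₁ t`, `d = deg P̄ ≥ 2`, weak transform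
`J′ = (J R′ : (φ u₁)^μ)`).

ASSEMBLY of PROVED tree lemmas (no facts, no definitions): the raw law
`alphaS_nr_add_and_mul_betaS_le` (`α′ + L = δ`, `d·β′ ≤ γ⁺ ≤ β`), monic transport
(`exists_monic_of_lt_deltaS`, `hasMonic_of_monic_of_chart` with `j = 1`), re-adaptation
(`exists_readapt`) and `w⁻`-preparation (`exists_wMinusPrepared`), both of which keep `α, β`:

* `exists_eq_pow_mul_of_mem_pow_nr` — cofactors in the non-rational chart: `φ(𝔪^μ) ⊆ ((φ u₁)^μ)`;
* `hasMonic_colon_nr` — the weak transform keeps a monic element (nearness `J′ ⊆ 𝔪′^μ`);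
* `betaS_nr_lt_of_alphaS_lt` — **`β′ < β`** for the transported system when `x` is quasi-isolated
  (`α < 1`, CoP1 (16)–(17): `β > 0`) and `d ≥ 2`;
* `exists_prepared_label_nonRationalStep_of_vPrepared` — **THE NON-RATIONAL POINT STEP WHEN THE
  TRANSPORTED SYSTEM IS `𝐯`-PREPARED** (CJS Cor. 14.6): a label `cs = (y⋆, φ u₁, P(t))` at `x′`
  (`y⋆ − y′ ∈ (φ u₁) + 𝔪′²`), adapted, `𝐯`-prepared, `w⁻`-prepared, `J′` of order exactly `μ`,
  `α⋆ + L = δ` and `β⋆ < β`.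

The complementary case (transported system solvable at `v′`: CJS Lemmas 14.7–14.11, CoP1 (23)–(25))
is NOT in this file. AI-written; weaker than expert review.

## Sources

* V. Cossart, O. Piltant, J. Algebra 320 (2008), proof of Lemma 4.5 (2), pp. 12–13, (16)–(17), (22).
  [CossartPiltant2008]
* V. Cossart, U. Jannsen, S. Saito, LNM 2270 (2020), Lemma 14.5, Corollary 14.6. [CossartJannsenSaito2020]
-/

noncomputable section

open IsLocalRing MvPolynomial

namespace Literature.AlgebraicGeometry.Resolution

universe u

section NonRationalStep

variable {R R' : Type u} [CommRing R] [CommRing R'] (φ : R →+* R') {c : Fin 3 → R}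
  {c' : Fin 3 → R'} (h₁ : c' 1 = φ (c 1)) (h₀ : φ (c 0) = φ (c 1) * c' 0) {t : R'}
  (ht : φ (c 2) = φ (c 1) * t) {P : Polynomial R} (hP : c' 2 = Polynomial.eval₂ φ t P)
  [IsRegularLocalRing R] [IsRegularLocalRing R']
  (hgen : Ideal.span {c 0, c 1, c 2} = maximalIdeal R) (hdim : ringKrullDim R = 3)
  (hgen' : Ideal.span {c' 0, c' 1, c' 2} = maximalIdeal R') (hdim' : ringKrullDim R' = 3)
  (hres : ∀ G : Polynomial R, Polynomial.eval₂ φ t G ∈ maximalIdeal R' ↔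
    Polynomial.map (residue R) P ∣ Polynomial.map (residue R) G)
  {J : Ideal R} {μ : ℕ}

omit [IsRegularLocalRing R'] in
include h₀ ht hgen in
/-- In the non-rational chart `φ(𝔪^μ) R′ ⊆ ((φ u₁)^μ)`: every `g ∈ 𝔪^μ` has a cofactor
`φ(g) = φ(u₁)^μ g′`. [cite: CossartJannsenSaito2020, Lemma 14.1] -/
theorem exists_eq_pow_mul_of_mem_pow_nr {g : R} (hg : g ∈ maximalIdeal R ^ μ) :
    ∃ g' : R', φ g = φ (c 1) ^ μ * g' := by
  have h1 : φ g ∈ ((maximalIdeal R).map φ) ^ μ := by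
    rw [← Ideal.map_pow]; exact Ideal.mem_map_of_mem _ hg
  have h2 : ((maximalIdeal R).map φ) ^ μ ≤ Ideal.span {φ (c 1) ^ μ} := by
    rw [← Ideal.span_singleton_pow]
    exact Ideal.pow_right_mono (map_maximalIdeal_le_span_nr φ hgen h₀ ht) μ
  obtain ⟨g', hg'⟩ := Ideal.mem_span_singleton'.mp (h2 h1)
  exact ⟨g', by rw [← hg', mul_comm]⟩

include h₁ h₀ ht hgen hdim hgen' hdim' in
/-- **The weak transform keeps a monic element** in the non-rational chart (CJS Lemma 14.1 (2): the
transform `f′ = f/u₁^{n}` of the element with `in_𝔪(f) = Y^μ` has `Y′^μ` with a unit coefficient, by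
nearness `J′ ⊆ 𝔪′^μ`). [cite: CossartJannsenSaito2020, Lemma 14.1 (2)] [cite: CossartPiltant2008, (11)] -/
theorem hasMonic_colon_nr (hJμ : J ≤ maximalIdeal R ^ μ) (hord : ∃ g ∈ J, g ∉ maximalIdeal R ^ (μ + 1))
    (hδ : μ.factorial < deltaS c J μ)
    (hJμ' : Submodule.colon (Ideal.map φ J) ({φ (c 1) ^ μ} : Set R') ≤ maximalIdeal R' ^ μ) :
    HasMonic c' (Submodule.colon (Ideal.map φ J) ({φ (c 1) ^ μ} : Set R')) μ := by
  obtain ⟨g, hgJ, hg⟩ := hord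
  obtain ⟨f, hfu, hgr⟩ := exists_monic_of_lt_deltaS c hgen hdim hJμ hδ hgJ hg
  obtain ⟨g', hg'⟩ := exists_eq_pow_mul_of_mem_pow_nr φ h₀ ht hgen (hJμ hgJ)
  have hg'J : g' ∈ Submodule.colon (Ideal.map φ J) ({φ (c 1) ^ μ} : Set R') := by
    rw [Submodule.mem_colon_singleton, smul_eq_mul, mul_comm, ← hg']
    exact Ideal.mem_map_of_mem _ hgJ
  have hφ : (maximalIdeal R).map φ ≤ Ideal.span {c' 1, c' 2} := by
    refine (map_maximalIdeal_le_span_nr φ hgen h₀ ht).trans ?_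
    rw [← h₁]
    exact Ideal.span_mono (by simp)
  exact hasMonic_of_monic_of_chart φ hgen' hdim' (Or.inl rfl) h₁ h₀ hφ hJμ' hgr (hfu.map φ) hg' hg'J

include h₁ h₀ ht hP hgen hdim hgen' hdim' hres in
/-- **`β′ < β` at a non-rational point for the transported system** (CoP1 (22) with (16)–(17); CJS
Lemma 14.5 with the proof of Corollary 14.6): `d · β′ ≤ γ⁺ ≤ β`, and `β > 0` because `α < 1 < δ ≤ α + β`;
as `d ≥ 2`, `β′ ≤ β/2 < β`. Also `α′ + L = δ` and the transported polygon is nonempty.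
[cite: CossartPiltant2008, Lemma 4.5 (2), (22)] [cite: CossartJannsenSaito2020, Lemma 14.5] -/
theorem betaS_nr_lt_of_alphaS_lt (hd : 2 ≤ (Polynomial.map (residue R) P).natDegree)
    (hJμ : J ≤ maximalIdeal R ^ μ) (hne : (pts c J μ).Nonempty) (hδ : μ.factorial < deltaS c J μ)
    (hα : alphaS c J μ < μ.factorial) :
    (pts c' (Submodule.colon (Ideal.map φ J) ({φ (c 1) ^ μ} : Set R')) μ).Nonempty ∧
      alphaS c' (Submodule.colon (Ideal.map φ J) ({φ (c 1) ^ μ} : Set R')) μ + μ.factorial =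
        deltaS c J μ ∧
      betaS c' (Submodule.colon (Ideal.map φ J) ({φ (c 1) ^ μ} : Set R')) μ < betaS c J μ := by
  have hPu : ¬ IsUnit (Polynomial.map (residue R) P) := fun hu => by
    have := Polynomial.natDegree_eq_zero_of_isUnit hu
    omega
  obtain ⟨hne', hα', hβ'⟩ := alphaS_nr_add_and_mul_betaS_le φ h₁ h₀ ht hP hgen hdim hgen' hdim' hres
    hPu (by omega) hJμ hne hδ
  refine ⟨hne', hα', ?_⟩
  have hγβ := gammaPlusS_le_betaS (c := c) (J := J) (μ := μ) hne
  have hδαβ := deltaS_le_alphaS_add_betaS (c := c) (J := J) (μ := μ) hne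
  have h2 : 2 * betaS c' (Submodule.colon (Ideal.map φ J) ({φ (c 1) ^ μ} : Set R')) μ ≤
      (Polynomial.map (residue R) P).natDegree *
        betaS c' (Submodule.colon (Ideal.map φ J) ({φ (c 1) ^ μ} : Set R')) μ :=
    Nat.mul_le_mul_right _ hd
  omega

include h₁ h₀ ht hP hgen hdim hgen' hdim' hres in
/-- **THE NON-RATIONAL POINT STEP WHEN THE TRANSPORTED SYSTEM IS `𝐯`-PREPARED** (CJS Corollary 14.6
with the re-adaptation of Lemma 11.4 and `w⁻`-preparation; CoP1 Lemma 4.5 (2) at a point `x′` of the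
first chart not rational over `x`, case «`Δ(E′; u′₁, v′; z′)` is prepared»). Input at `x`:
`c = (y, u₁, u₂)`, `J ⊆ 𝔪^μ` of order exactly `μ`, adapted (`δ > L`), quasi-isolated (`α < L`); the
non-rational chart `c′ = (y′, φ u₁, P(t))`, `d = deg P̄ ≥ 2`, residue criterion `hres`; the weak
transform `J′` (passed with its defining equation) very near (`J′ ⊆ 𝔪′^μ`, `τ′ = 1`) and
`𝐯`-PREPARED for `c′`. Output at `x′`: `cs = (y⋆, φ u₁, P(t))`, `cs₁ = c′₁`, `cs₂ = c′₂`,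
`y⋆ − y′ ∈ (c′₁) + 𝔪′²`, adapted, `𝐯`-prepared, `w⁻`-prepared, `J′` of order exactly `μ`,
`α⋆ + L = δ` and `β⋆ < β`. (`𝐯`- or `w⁻`-preparedness at `x` is not needed in this case.)
[cite: CossartJannsenSaito2020, Corollary 14.6] [cite: CossartPiltant2008, Lemma 4.5 (2), (22)] -/
theorem exists_prepared_label_nonRationalStep_of_vPrepared
    {J' : Ideal R'} (hJ'def : J' = Submodule.colon (Ideal.map φ J) ({φ (c 1) ^ μ} : Set R'))
    (hd : 2 ≤ (Polynomial.map (residue R) P).natDegree)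
    (hJμ : J ≤ maximalIdeal R ^ μ) (hord : ∃ g ∈ J, g ∉ maximalIdeal R ^ (μ + 1))
    (hne : (pts c J μ).Nonempty) (hδ : μ.factorial < deltaS c J μ) (hα : alphaS c J μ < μ.factorial)
    (hJμ' : J' ≤ maximalIdeal R' ^ μ) (hτ' : hironakaTauAt c' J' μ = 1)
    (hvprep' : VPrepared c' J' μ) :
    ∃ cs : Fin 3 → R', cs 1 = c' 1 ∧ cs 2 = c' 2 ∧
      cs 0 - c' 0 ∈ Ideal.span {c' 1} ⊔ maximalIdeal R' ^ 2 ∧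
      Ideal.span {cs 0, cs 1, cs 2} = maximalIdeal R' ∧ (pts cs J' μ).Nonempty ∧
      μ.factorial < deltaS cs J' μ ∧ VPrepared cs J' μ ∧ WMinusPrepared cs J' μ ∧
      (∃ g ∈ J', g ∉ maximalIdeal R' ^ (μ + 1)) ∧
      alphaS cs J' μ + μ.factorial = deltaS c J μ ∧ betaS cs J' μ < betaS c J μ := by
  classical
  subst hJ'def
  set J' : Ideal R' := Submodule.colon (Ideal.map φ J) ({φ (c 1) ^ μ} : Set R') with hJ'eq
  -- the raw transported system: nonempty polygon, `α′ + L = δ`, `β′ < β`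
  obtain ⟨hne', hα', hβ'⟩ :=
    betaS_nr_lt_of_alphaS_lt φ h₁ h₀ ht hP hgen hdim hgen' hdim' hres hd hJμ hne hδ hα
  -- a monic element survives; order exactly `μ`
  have hmon' : HasMonic c' J' μ := hasMonic_colon_nr φ h₁ h₀ ht hgen hdim hgen' hdim' hJμ hord hδ hJμ'
  have hord' : ∃ g ∈ J', g ∉ maximalIdeal R' ^ (μ + 1) := hmon'.exists_not_mem_pow_succ c' hgen' hdim' hJμ'
  -- re-adaptation `y′ ↦ y′ + b̃ · φ u₁`
  obtain ⟨bt, hgen'', -, hne'', hα'', hβ'', hvprep'', -, hδ''⟩ :=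
    exists_readapt c' hgen' hdim' hJμ' hne' hvprep' hτ' hmon'
  set c'' : Fin 3 → R' := shiftZ c' (shiftMon c' bt 1 0) with hc''
  -- `w⁻`-preparation keeping `v`
  obtain ⟨cs, hcs1, hcs2, hcs0, hgens, -, hnes, hαs, hβs, hvpreps, hδs, hwpreps⟩ :=
    exists_wMinusPrepared hdim' _ c'' hgen'' hne'' hδ'' hvprep'' le_rfl
  have hc''0 : c'' 0 = c' 0 + bt * (c' 1 ^ 1 * c' 2 ^ 0) := rfl
  have hc''1 : c'' 1 = c' 1 := rfl
  have hc''2 : c'' 2 = c' 2 := rfl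
  refine ⟨cs, hcs1.trans hc''1, hcs2.trans hc''2, ?_, hgens, hnes, lt_of_lt_of_le hδ'' hδs, hvpreps,
    hwpreps, hord', ?_, ?_⟩
  · have hsplit : cs 0 - c' 0 = (cs 0 - c'' 0) + bt * c' 1 := by rw [hc''0]; ring
    rw [hsplit]
    exact Ideal.add_mem _ (Ideal.mem_sup_right hcs0)
      (Ideal.mem_sup_left (Ideal.mul_mem_left _ _ (Ideal.subset_span rfl)))
  · rw [hαs, hα'', hα']
  · rw [hβs, hβ'']; exact hβ'

end NonRationalStep

end Literature.AlgebraicGeometry.Resolution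

end
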